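import Summits.CriticalPhenomena.SAWScalingLimit.Theorems.SAWDefectDecoherenceObservableToSLERCarvedReductionSqueezeInnerOneSided
import Summits.CriticalPhenomena.SAWScalingLimit.Theorems.SAWDefectDecoherenceObservableToSLERCarvedReductionSqueezeInnerDisc
import Literature.Probability.RandomPlanarGeometry.HullThickening
import Literature.Probability.RandomPlanarGeometry.HullSubdomainPullback
import HarnessLib

/-!
# The inner approximant of the limit bulk: construction and hull bounds (piece (K4f) of stub
# 5a4″ `stub_carvedReduction_squeezeSolid`)

Piece of stub 5a4″ `stub_carvedReduction_squeezeSolid`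
(`TwoPieceAdmRestrictionLimit → MovingCarvingSqueezeP FatAnchoredClassZeroSolid`) of the line
`bridge-gate-renewal` (r11) of the crux `SAWDefectDecoherence.ObservableToSLER`
(stmt-CriticalPhenomena-14005; twin T-A `stub_carvedReduction_squeezeGeometry` of
stmt-CriticalPhenomena-10472), contract `InnerApproximant` (twin memo items 5/6-input).  Given the
limit bulk `Ω` (bounded open, `Ωᶜ` preconnected) with a disc uniformizer `ψ` whose extension `ψ̄`
is continuous on the closed disc, the two-piece flat super-domain `E ⊇ Ω` (chordal uniformizer
`φ`, windows `{im > im E.pt i} ∩ B(E.pt i, ρE) ⊆ Ω`), a window scale `ρM ≤ ρE`, a bound `θmax`,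
and a lift `Θ` whose loop `e ∘ Θ` passes through preimages `ζ i` of the gate points `E.pt i` at
the marks: radii `r₁, R₁` (from `φ` at `0`, `∞`) such that for all `r' ≤ r₁`, `R' ≥ R₁`,
`δ₀, θ > 0` THE INNER DOMAIN `M' = ψ̄ (U)`, `U = {‖z‖ < r(z/‖z‖)}` with the profile
`r = 1 - θ₄ min (1, dist(·, Σ⁺))`, `Σ⁺ = ∂𝔻 ∩ ψ̄⁻¹(B(E.pt 0, ρM/2) ∪ B(E.pt 1, ρM/2))`, satisfies:
marks and loop `t ↦ ψ̄ (r(e(Θ t)) e(Θ t))` (for clause (C2)), `1 - θmax ≤ r ≤ 1`,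
`E.IsHullSubdomain M'`, `M' ⊆ Ω`, flat at `E.pt i` on `B(E.pt i, ρM/4)`,
`closure M' ⊆ Kc ∪ ⋃ B(E.pt i, ρM)` with `Kc ⊆ Ω` compact, and the hull sandwich
`A ⊆ φ.pullbackHull M' ⊆ thickHull A δ₀ ∪ {im ≤ θ, r' ≤ |z| ≤ R'}`, `A = cl(ℍ ∖ φ⁻¹ Ω)` — the
input of `stub_carvedReduction_derivFrame` (p129409).  Key choice: `θ₄` so small that the compact
`K₁ = {im ≥ θ, |z| ≤ R', dist(·, A) ≥ δ₀}` pulls back into `B(0, 1 - θ₄)` and that `ψ̄` moves by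
`< ρM/4` over distances `≤ θ₄` (then `U ⊇ ψ⁻¹(Ω ∩ B(E.pt i, ρM/4))`).

* `stub_carvedReduction_innerDomain` — the statement above (registered).

Sources: G. F. Lawler, O. Schramm, W. Werner, J. Amer. Math. Soc. 16 (2003) §2 (hulls, fillings);
Ch. Pommerenke, Boundary Behaviour of Conformal Maps (1992), Thm. 2.1.
-/

noncomputable section
open Set Filter Metric Topology Complex Real Function Bornology
open UpperHalfPlane (upperHalfPlaneSet isOpen_upperHalfPlaneSet)
open Literature.Probability.RandomPlanarGeometry

namespace Summit.CriticalPhenomena.SAWScalingLimit.Theorems.ObservableToSLER.Squeeze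

/-! ### The chordal uniformizer near `0` and `∞` -/

/-- Near `0` a chordal uniformizer maps into any ball about `E.pt 0`. -/
theorem exists_radius_zero {E : DobrushinDomain} {φ : ConformalEquiv upperHalfPlaneSet E.carrier}
    (hφ : E.IsChordalUniformizing φ) {ρ : ℝ} (hρ : 0 < ρ) :
    ∃ r₁ > (0 : ℝ), ∀ w ∈ upperHalfPlaneSet, ‖w‖ < r₁ → φ w ∈ ball (E.pt 0) ρ := by
  have hev : ∀ᶠ z in 𝓝[upperHalfPlaneSet] (0 : ℂ), φ z ∈ ball (E.pt 0) ρ :=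
    hφ.1 (isOpen_ball.mem_nhds (mem_ball_self hρ))
  obtain ⟨r₁, hr₁, h⟩ := Metric.eventually_nhds_iff.1 (eventually_nhdsWithin_iff.1 hev)
  exact ⟨r₁, hr₁, fun w hw hwr => h (by rwa [dist_zero_right]) hw⟩

/-- Near `∞` a chordal uniformizer maps into any ball about `E.pt 1`. -/
theorem exists_radius_infty {E : DobrushinDomain} {φ : ConformalEquiv upperHalfPlaneSet E.carrier}
    (hφ : E.IsChordalUniformizing φ) {ρ : ℝ} (hρ : 0 < ρ) :
    ∃ R₁ : ℝ, ∀ w ∈ upperHalfPlaneSet, R₁ < ‖w‖ → φ w ∈ ball (E.pt 1) ρ := by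
  have hev : ∀ᶠ z in cocompact ℂ ⊓ 𝓟 upperHalfPlaneSet, φ z ∈ ball (E.pt 1) ρ :=
    hφ.2 (isOpen_ball.mem_nhds (mem_ball_self hρ))
  rw [Filter.eventually_inf_principal, ← Metric.cobounded_eq_cocompact] at hev
  obtain ⟨R₁, -, hR⟩ := (Filter.hasBasis_cobounded_norm.eventually_iff).1 hev
  exact ⟨R₁, fun w hw hwR => hR hwR.le hw⟩

/-! ### Windows: the frontier near a flat gate lies on the gate line -/

/-- If the open upper half of `ball g ρ` lies in `Ω` and its closed lower half in `Ωᶜ`, every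
frontier point of `Ω` in `ball g ρ` lies on the line `im = im g`. -/
theorem frontier_window_im {Ω : Set ℂ} {g : ℂ} {ρ : ℝ}
    (hup : {z : ℂ | g.im < z.im} ∩ ball g ρ ⊆ Ω) (hlow : {z : ℂ | z.im ≤ g.im} ∩ ball g ρ ⊆ Ωᶜ)
    {w : ℂ} (hw : w ∈ frontier Ω) (hwg : w ∈ ball g ρ) : w.im = g.im := by
  rw [frontier_eq_closure_inter_closure] at hw
  rcases lt_trichotomy w.im g.im with hlt | heq | hgt
  · -- below the line: an open neighbourhood inside `Ωᶜ`
    exfalso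
    have hO : ({z : ℂ | z.im < g.im} ∩ ball g ρ) ∈ 𝓝 w :=
      ((isOpen_lt continuous_im continuous_const).inter isOpen_ball).mem_nhds ⟨hlt, hwg⟩
    obtain ⟨z, hzO, hzΩ⟩ := mem_closure_iff_nhds.1 hw.1 _ hO
    exact hlow ⟨(le_of_lt hzO.1 : z.im ≤ g.im), hzO.2⟩ hzΩ
  · exact heq
  · exfalso
    have hO : ({z : ℂ | g.im < z.im} ∩ ball g ρ) ∈ 𝓝 w :=
      ((isOpen_lt continuous_const continuous_im).inter isOpen_ball).mem_nhds ⟨hgt, hwg⟩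
    obtain ⟨z, hzO, hzΩ⟩ := mem_closure_iff_nhds.1 hw.2 _ hO
    exact hzΩ (hup hzO)

/-! ### The inner domain -/

/-- **Registered sub-goal `stub_carvedReduction_innerDomain`** (crux item stmt-CriticalPhenomena-14005,
stub 5a4″ `stub_carvedReduction_squeezeSolid`, piece (K4f) THE INNER DOMAIN): see the module
docstring. [cite: LawlerSchrammWerner2003Restriction, §2 p. 8 (hulls and fillings)] -/
theorem stub_carvedReduction_innerDomain :
    ∀ (Ω : Set ℂ) (ψ : ConformalEquiv (ball (0 : ℂ) 1) Ω) (E : DobrushinDomain)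
      (φ : ConformalEquiv upperHalfPlaneSet E.carrier) (ρE ρM θmax σ : ℝ) (Θ : ℝ → ℝ)
      (mk : Fin 2 → ℝ) (ζ : Fin 2 → ℂ),
      IsOpen Ω → IsBounded Ω → IsPreconnected Ωᶜ →
      ContinuousOn (extendFrom (ball 0 1) ψ) (closedBall (0 : ℂ) 1) →
      (∀ x ∈ closedBall (0 : ℂ) 1, Tendsto ψ (𝓝[ball 0 1] x) (𝓝 (extendFrom (ball 0 1) ψ x))) →
      E.IsChordalUniformizing φ → 0 < ρE → 0 < ρM → ρM ≤ ρE → 0 < θmax →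
      (∀ i : Fin 2, E.carrier ∩ ball (E.pt i) ρE = {z : ℂ | (E.pt i).im < z.im} ∩ ball (E.pt i) ρE) →
      (∀ i : Fin 2, {z : ℂ | (E.pt i).im < z.im} ∩ ball (E.pt i) ρE ⊆ Ω) → Ω ⊆ E.carrier →
      (E.carrier \ Ω).Nonempty →
      (σ = 1 ∨ σ = -1) → Continuous Θ → Injective Θ → (∀ t, Θ (t + 1) = Θ t + σ) →
      StrictMono mk → (∀ i, mk i ∈ Ico (0 : ℝ) 1) →
      (∀ i, ‖ζ i‖ = 1 ∧ extendFrom (ball 0 1) ψ (ζ i) = E.pt i ∧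
        circleMap 0 1 (2 * π * Θ (mk i)) = ζ i) →
      ∃ r₁ > (0 : ℝ), ∃ R₁ : ℝ, ∀ (r' R' δ₀ θ : ℝ), 0 < r' → r' ≤ r₁ → R₁ ≤ R' → 0 < δ₀ → 0 < θ →
        ∃ (M' : DobrushinDomain) (r : ℂ → ℝ),
          (∀ z, 1 - θmax ≤ r z ∧ r z ≤ 1) ∧ M'.mark = mk ∧
          (∀ t, M'.boundary t = extendFrom (ball 0 1) ψ
            (((r (circleMap 0 1 (2 * π * Θ t)) : ℝ) : ℂ) * circleMap 0 1 (2 * π * Θ t))) ∧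
          E.IsHullSubdomain M' ∧ M'.carrier ⊆ Ω ∧
          (∀ i : Fin 2, M'.carrier ∩ ball (E.pt i) (ρM / 4) =
            {z : ℂ | (E.pt i).im < z.im} ∩ ball (E.pt i) (ρM / 4)) ∧
          (∃ Kc : Set ℂ, IsCompact Kc ∧ Kc ⊆ Ω ∧
            closure M'.carrier ⊆ Kc ∪ ⋃ i : Fin 2, ball (E.pt i) ρM) ∧
          closure (upperHalfPlaneSet \ φ.symm '' Ω) ⊆ φ.pullbackHull M' ∧
          φ.pullbackHull M' ⊆ thickHull (closure (upperHalfPlaneSet \ φ.symm '' Ω)) δ₀ ∪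
            {z : ℂ | z.im ≤ θ ∧ r' ≤ ‖z‖ ∧ ‖z‖ ≤ R'} ∧
          M'.carrier = extendFrom (ball 0 1) ψ '' {w : ℂ | ‖w‖ < r ((‖w‖⁻¹ : ℝ) • w)} ∧
          closure M'.carrier ⊆ extendFrom (ball 0 1) ψ '' ball 0 1 ∪
            extendFrom (ball 0 1) ψ '' {z : ℂ | ‖z‖ = 1 ∧ r z = 1} ∧
          (∀ z, ‖z‖ = 1 → r z = 1 →
            extendFrom (ball 0 1) ψ z ∈ ⋃ i : Fin 2, closedBall (E.pt i) (ρM / 2)) := by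
  intro Ω ψ E φ ρE ρM θmax σ Θ mk ζ hΩo hΩb hΩc hΦc htend hφ hρE hρM hρME hθmax hflat hwin hΩE
    hEΩ hσ hΘc hΘi hper hmk hmem hζ
  set Φ := extendFrom (ball 0 1) ψ with hΦdef
  set A : Set ℂ := closure (upperHalfPlaneSet \ φ.symm '' Ω) with hA
  have hext : ∀ x ∈ ball (0 : ℂ) 1, Φ x = ψ x := fun x hx => extendFrom_extends ψ.continuousOn x hx
  -- radii from the behaviour of `φ` at `0` and `∞`
  obtain ⟨r₁, hr₁, hr₁φ⟩ := exists_radius_zero hφ (by positivity : 0 < ρM / 4)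
  obtain ⟨R₁, hR₁φ⟩ := exists_radius_infty hφ (by positivity : 0 < ρM / 4)
  refine ⟨r₁, hr₁, R₁, fun r' R' δ₀ θ hr' hr'₁ hR₁' hδ₀ hθ => ?_⟩
  -- `ℍ ∖ A ⊆ φ⁻¹ Ω`
  have hHA : ∀ w ∈ upperHalfPlaneSet, w ∉ A → φ w ∈ Ω := by
    intro w hw hwA
    by_contra hφw
    exact hwA (subset_closure ⟨hw, fun ⟨o, ho, how⟩ => hφw (by rw [← how, φ.apply_symm_apply (hΩE ho)]; exact ho)⟩)
  -- the compact `K₁` and its pull-back into the disc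
  set K₁ : Set ℂ := {w : ℂ | θ ≤ w.im ∧ ‖w‖ ≤ R' ∧ δ₀ ≤ infDist w A} with hK₁
  have hK₁c : IsCompact K₁ := by
    refine Metric.isCompact_of_isClosed_isBounded ?_ ?_
    · exact (isClosed_le continuous_const continuous_im).inter
        ((isClosed_le continuous_norm continuous_const).inter
          (isClosed_le continuous_const (continuous_infDist_pt A)))
    · exact (isBounded_closedBall (x := (0 : ℂ)) (r := R')).subset fun w hw =>
        mem_closedBall_zero_iff.2 hw.2.1
  have hK₁H : K₁ ⊆ upperHalfPlaneSet := fun w hw => lt_of_lt_of_le hθ hw.1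
  have hK₁A : ∀ w ∈ K₁, w ∉ A := by
    intro w hw hwA
    have h0 : infDist w A = 0 := infDist_zero_of_mem hwA
    linarith [hw.2.2]
  have hK₁Ω : ∀ w ∈ K₁, φ w ∈ Ω := fun w hw => hHA w (hK₁H hw) (hK₁A w hw)
  have hK₁img : IsCompact (ψ.symm '' (φ '' K₁)) := by
    refine (hK₁c.image_of_continuousOn (φ.continuousOn.mono hK₁H)).image_of_continuousOn ?_
    exact ψ.symm.continuousOn.mono (by rintro _ ⟨w, hw, rfl⟩; exact hK₁Ω w hw)
  obtain ⟨m, hm1, hmK⟩ : ∃ m < (1 : ℝ), ∀ z ∈ ψ.symm '' (φ '' K₁), ‖z‖ ≤ m := by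
    rcases (ψ.symm '' (φ '' K₁)).eq_empty_or_nonempty with he | hne
    · exact ⟨0, one_pos, fun z hz => by rw [he] at hz; exact absurd hz (notMem_empty _)⟩
    · obtain ⟨z₀, hz₀, hmax⟩ := hK₁img.exists_isMaxOn hne continuous_norm.continuousOn
      refine ⟨‖z₀‖, ?_, fun z hz => hmax hz⟩
      obtain ⟨_, ⟨w, hw, rfl⟩, rfl⟩ := hz₀
      exact mem_ball_zero_iff.1 (ψ.symm_mapsTo (hK₁Ω w hw))
  -- uniform continuity of `Φ` on the closed disc at scale `ρM/4`
  obtain ⟨ω, hω, hωΦ⟩ : ∃ ω > (0 : ℝ), ∀ x ∈ closedBall (0 : ℂ) 1, ∀ y ∈ closedBall (0 : ℂ) 1,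
      dist x y < ω → dist (Φ x) (Φ y) < ρM / 4 :=
    Metric.uniformContinuousOn_iff.1 ((isCompact_closedBall 0 1).uniformContinuousOn_of_continuous
      hΦc) (ρM / 4) (by positivity)
  -- the thickness `θ₄`
  set θ₄ : ℝ := min (min (θmax / 2) (1 / 2)) (min ((1 - m) / 2) (ω / 2)) with hθ₄def
  have hθ₄pos : 0 < θ₄ := by positivity
  have hθ₄max : θ₄ ≤ θmax / 2 := (min_le_left _ _).trans (min_le_left _ _)
  have hθ₄half : θ₄ ≤ 1 / 2 := (min_le_left _ _).trans (min_le_right _ _)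
  have hθ₄m : θ₄ ≤ (1 - m) / 2 := (min_le_right _ _).trans (min_le_left _ _)
  have hθ₄ω : θ₄ ≤ ω / 2 := (min_le_right _ _).trans (min_le_right _ _)
  -- the window arcs `Σ⁺` and the profile `r`
  set Sig : Set ℂ := {z : ℂ | ‖z‖ = 1 ∧ Φ z ∈ ⋃ i : Fin 2, ball (E.pt i) (ρM / 2)} with hSig
  have hSigne : Sig.Nonempty := ⟨ζ 0, (hζ 0).1, mem_iUnion.2 ⟨0, by
    rw [(hζ 0).2.1]; exact mem_ball_self (by positivity)⟩⟩
  set r : ℂ → ℝ := fun z => 1 - θ₄ * min 1 (infDist z Sig) with hrdef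
  have hrc : Continuous r := by
    simp only [hrdef]
    exact continuous_const.sub (continuous_const.mul (continuous_const.min (continuous_infDist_pt _)))
  have hrb : ∀ z, 1 - θ₄ ≤ r z ∧ r z ≤ 1 := by
    intro z
    have h1 : 0 ≤ min 1 (infDist z Sig) := le_min zero_le_one infDist_nonneg
    have h2 : min 1 (infDist z Sig) ≤ 1 := min_le_left _ _
    constructor
    · simp only [hrdef]; nlinarith
    · simp only [hrdef]; nlinarith
  have hrb' : ∀ z, 1 - θmax ≤ r z ∧ r z ≤ 1 := fun z =>
    ⟨by linarith [(hrb z).1, hθmax], (hrb z).2⟩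
  have hrmin : 0 < 1 - θ₄ := by linarith
  have hr1 : ∀ z, r z = 1 ↔ z ∈ closure Sig := by
    intro z
    rw [mem_closure_iff_infDist_zero hSigne]
    simp only [hrdef]
    constructor
    · intro h
      have : min 1 (infDist z Sig) = 0 := by nlinarith [hθ₄pos]
      rcases min_eq_iff.1 this with ⟨h1, -⟩ | ⟨h1, -⟩
      · norm_num at h1
      · exact h1
    · intro h; rw [h, min_eq_right (zero_le_one)]; ring
  have hSigcl : closure Sig ⊆ {z : ℂ | ‖z‖ = 1 ∧ Φ z ∈ ⋃ i : Fin 2, closedBall (E.pt i) (ρM / 2)} := by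
    refine closure_minimal (fun z hz => ⟨hz.1, ?_⟩) ?_
    · obtain ⟨i, hi⟩ := mem_iUnion.1 hz.2
      exact mem_iUnion.2 ⟨i, ball_subset_closedBall hi⟩
    · have hsph : {z : ℂ | ‖z‖ = 1 ∧ Φ z ∈ ⋃ i : Fin 2, closedBall (E.pt i) (ρM / 2)} =
          sphere (0 : ℂ) 1 ∩ Φ ⁻¹' (⋃ i : Fin 2, closedBall (E.pt i) (ρM / 2)) := by
        ext z; simp
      rw [hsph]
      exact (hΦc.mono sphere_subset_closedBall).preimage_isClosed_of_isClosed isClosed_sphere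
        (isClosed_iUnion_of_finite fun i => isClosed_closedBall)
  -- one-sidedness of the window points and injectivity of `Φ` on `𝔻 ∪ {r = 1}`
  have hlow : ∀ i : Fin 2, {z : ℂ | z.im ≤ (E.pt i).im} ∩ ball (E.pt i) ρE ⊆ Ωᶜ := by
    intro i z hz hzΩ
    have : z ∈ E.carrier ∩ ball (E.pt i) ρE := ⟨hΩE hzΩ, hz.2⟩
    rw [hflat i] at this
    have h1 : (E.pt i).im < z.im := this.1
    exact (not_lt.2 hz.1) h1
  have hfr : ∀ z, ‖z‖ = 1 → Φ z ∈ frontier Ω := fun z hz =>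
    extendFrom_mem_frontier' ψ hΩo hz (htend z (mem_closedBall_zero_iff.2 hz.le))
  have hcut : ∀ z ∈ {z : ℂ | ‖z‖ = 1 ∧ r z = 1}, IsConnected (Ωᶜ \ {Φ z}) := by
    rintro z ⟨hz1, hrz⟩
    obtain ⟨-, hzi⟩ := hSigcl ((hr1 z).1 hrz)
    obtain ⟨i, hi⟩ := mem_iUnion.1 hzi
    have hwg : dist (Φ z) (E.pt i) < ρE := by
      linarith [mem_closedBall.1 hi]
    have him : (Φ z).im = (E.pt i).im := frontier_window_im (hwin i) (hlow i) (hfr z hz1) hwg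
    refine isConnected_compl_diff_of_window hΩc (hwin i) (hlow i) him hwg ?_
    -- a far point of `Ωᶜ`
    obtain ⟨R, hR⟩ := hΩb.subset_closedBall (Φ z)
    refine ⟨Φ z + ((|R| + 1 : ℝ) : ℂ), fun h => ?_, fun h => ?_⟩
    · have := mem_closedBall.1 (hR h)
      rw [dist_eq_norm, add_sub_cancel_left, Complex.norm_real, Real.norm_eq_abs,
        abs_of_pos (by positivity)] at this
      linarith [le_abs_self R]
    · have h' : ((|R| + 1 : ℝ) : ℂ) = 0 := by
        have := mem_singleton_iff.1 h
        simpa using this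
      have : (|R| + 1 : ℝ) = 0 := by exact_mod_cast h'
      linarith [abs_nonneg R]
  have hhi : InjOn Φ (ball 0 1 ∪ {z : ℂ | ‖z‖ = 1 ∧ r z = 1}) :=
    injOn_extendFrom_ball_union ψ hΩo hΩb hΦc htend (fun z hz => mem_sphere_zero_iff_norm.2 hz.1) hcut
  -- the star image
  obtain ⟨M', hMc, hMb, hMmk, hMpt, hMsub, hMcl⟩ := stub_carvedReduction_starImage Θ σ hσ hΘc hΘi
    hper mk hmk hmem r (1 - θ₄) hrc hrmin hrb Φ hΦc hhi
  -- `M' ⊆ Ω`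
  have hMΩ : M'.carrier ⊆ Ω := by
    refine hMsub.trans ?_
    rintro _ ⟨z, hz, rfl⟩
    rw [hext z hz]; exact ψ.mapsTo hz
  -- the key containment `Ω ∩ B(E.pt i, ρM/4) ⊆ M'`
  have hkey : ∀ i : Fin 2, Ω ∩ ball (E.pt i) (ρM / 4) ⊆ M'.carrier := by
    intro i w ⟨hwΩ, hwB⟩
    set z := ψ.symm w with hz
    have hz1 : z ∈ ball (0 : ℂ) 1 := ψ.symm_mapsTo hwΩ
    have hzw : Φ z = w := by rw [hext z hz1, hz, ψ.apply_symm_apply hwΩ]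
    rw [hMc]
    refine ⟨z, ?_, hzw⟩
    show ‖z‖ < r ((‖z‖⁻¹ : ℝ) • z)
    by_contra hnot
    push Not at hnot
    have hz1' : ‖z‖ < 1 := mem_ball_zero_iff.1 hz1
    have hzn : 1 - θ₄ ≤ ‖z‖ := (hrb _).1.trans hnot
    have hz0 : z ≠ 0 := by
      intro h; rw [h, norm_zero] at hzn; linarith
    set u : ℂ := (‖z‖⁻¹ : ℝ) • z with hu
    have hu1 : ‖u‖ = 1 := by
      rw [hu, norm_smul, norm_inv, norm_norm, inv_mul_cancel₀ (norm_ne_zero_iff.2 hz0)]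
    have hdist : dist z u < ω := by
      have : z - u = ((1 - ‖z‖⁻¹ : ℝ) : ℂ) * z := by
        rw [hu, Complex.real_smul]; push_cast; ring
      rw [dist_eq_norm, this, norm_mul, Complex.norm_real, Real.norm_eq_abs,
        abs_of_nonpos (by rw [sub_nonpos]; exact one_le_inv_iff₀.2 ⟨norm_pos_iff.2 hz0, hz1'.le⟩),
        neg_sub, sub_mul, inv_mul_cancel₀ (norm_ne_zero_iff.2 hz0), one_mul]
      linarith
    have hΦu : Φ u ∈ ball (E.pt i) (ρM / 2) := by
      have h1 := hωΦ z (ball_subset_closedBall hz1) u (mem_closedBall_zero_iff.2 hu1.le) hdist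
      rw [hzw] at h1
      rw [mem_ball]
      calc dist (Φ u) (E.pt i) ≤ dist (Φ u) w + dist w (E.pt i) := dist_triangle _ _ _
        _ < ρM / 4 + ρM / 4 := add_lt_add (by rwa [dist_comm]) (mem_ball.1 hwB)
        _ = ρM / 2 := by ring
    have huSig : u ∈ Sig := ⟨hu1, mem_iUnion.2 ⟨i, hΦu⟩⟩
    have hru : r u = 1 := (hr1 u).2 (subset_closure huSig)
    rw [hru] at hnot
    linarith
  -- flatness of `M'` at the gate points on `B(E.pt i, ρM/4)`
  have hMflat : ∀ i : Fin 2, M'.carrier ∩ ball (E.pt i) (ρM / 4) =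
      {z : ℂ | (E.pt i).im < z.im} ∩ ball (E.pt i) (ρM / 4) := by
    intro i
    have hb : ball (E.pt i) (ρM / 4) ⊆ ball (E.pt i) ρE := ball_subset_ball (by linarith)
    ext w
    constructor
    · rintro ⟨hwM, hwB⟩
      have : w ∈ E.carrier ∩ ball (E.pt i) ρE := ⟨hΩE (hMΩ hwM), hb hwB⟩
      rw [hflat i] at this
      exact ⟨this.1, hwB⟩
    · rintro ⟨hw, hwB⟩
      exact ⟨hkey i ⟨hwin i ⟨hw, hb hwB⟩, hwB⟩, hwB⟩
  -- the gate points of `M'` are those of `E`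
  have hζSig : ∀ i, ζ i ∈ Sig := fun i => ⟨(hζ i).1, mem_iUnion.2 ⟨i, by
    rw [(hζ i).2.1]; exact mem_ball_self (by positivity)⟩⟩
  have hrζ : ∀ i, r (ζ i) = 1 := fun i => (hr1 _).2 (subset_closure (hζSig i))
  have hpt : ∀ i, M'.pt i = E.pt i := by
    intro i
    rw [hMpt i, (hζ i).2.2, hrζ i, Complex.ofReal_one, one_mul, (hζ i).2.1]
  have hnotcl : ∀ i, E.pt i ∉ closure (E.carrier \ M'.carrier) := by
    intro i hcl
    obtain ⟨w, hwB, hwE, hwM⟩ :=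
      mem_closure_iff_nhds.1 hcl _ (ball_mem_nhds _ (by positivity : 0 < ρM / 4))
    have hb : ball (E.pt i) (ρM / 4) ⊆ ball (E.pt i) ρE := ball_subset_ball (by linarith)
    have h1 : w ∈ E.carrier ∩ ball (E.pt i) ρE := ⟨hwE, hb hwB⟩
    rw [hflat i] at h1
    have h2 : (E.pt i).im < w.im := h1.1
    have h3 : w ∈ M'.carrier ∩ ball (E.pt i) (ρM / 4) := by rw [hMflat i]; exact ⟨h2, hwB⟩
    exact hwM h3.1
  have hHull : E.IsHullSubdomain M' := ⟨hMΩ.trans hΩE, hpt 0, hpt 1, hnotcl 0, hnotcl 1⟩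
  -- compact containment away from the windows
  have hKc : ∃ Kc : Set ℂ, IsCompact Kc ∧ Kc ⊆ Ω ∧
      closure M'.carrier ⊆ Kc ∪ ⋃ i : Fin 2, ball (E.pt i) ρM := by
    have hMcpt : IsCompact (closure M'.carrier) := (hΩb.subset hMΩ).isCompact_closure
    refine ⟨closure M'.carrier \ ⋃ i : Fin 2, ball (E.pt i) ρM,
      hMcpt.diff (isOpen_iUnion fun i => isOpen_ball), ?_, fun w hw => ?_⟩
    · rintro w ⟨hw, hwB⟩
      rcases hMcl hw with ⟨z, hz, rfl⟩ | ⟨z, hz, rfl⟩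
      · rw [hext z hz]; exact ψ.mapsTo hz
      · exfalso
        have hz2 : r z = 1 := hz.2
        obtain ⟨-, hzi⟩ := hSigcl ((hr1 z).1 hz2)
        obtain ⟨i, hi⟩ := mem_iUnion.1 hzi
        exact hwB (mem_iUnion.2 ⟨i, closedBall_subset_ball (by linarith) hi⟩)
    · by_cases h : w ∈ ⋃ i : Fin 2, ball (E.pt i) ρM
      · exact Or.inr h
      · exact Or.inl ⟨hw, h⟩
  -- the hull sandwich: lower bound
  have hAne : A.Nonempty := by
    obtain ⟨e, heE, heΩ⟩ := hEΩ
    refine ⟨φ.symm e, subset_closure ⟨φ.symm_mapsTo heE, ?_⟩⟩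
    rintro ⟨o, ho, hoe⟩
    apply heΩ
    have h1 : φ (φ.symm o) = φ (φ.symm e) := by rw [hoe]
    rw [φ.apply_symm_apply (hΩE ho), φ.apply_symm_apply heE] at h1
    rw [← h1]; exact ho
  have hlower : A ⊆ φ.pullbackHull M' := by
    refine closure_mono (sdiff_subset_sdiff_right ?_)
    rintro z ⟨hz, hzM⟩
    exact ⟨φ z, hMΩ hzM, φ.symm_apply_apply hz⟩
  -- the hull sandwich: upper bound
  have hclosed : IsClosed (thickHull A δ₀ ∪ {z : ℂ | z.im ≤ θ ∧ r' ≤ ‖z‖ ∧ ‖z‖ ≤ R'}) :=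
    (isClosed_thickHull A δ₀).union ((isClosed_le continuous_im continuous_const).inter
      ((isClosed_le continuous_const continuous_norm).inter
        (isClosed_le continuous_norm continuous_const)))
  have hupper : φ.pullbackHull M' ⊆
      thickHull A δ₀ ∪ {z : ℂ | z.im ≤ θ ∧ r' ≤ ‖z‖ ∧ ‖z‖ ≤ R'} := by
    refine closure_minimal ?_ hclosed
    rintro z ⟨hzH, hzD⟩
    have hzim : 0 < z.im := hzH
    have hφz : φ z ∉ M'.carrier := fun h => hzD ⟨hzH, h⟩
    by_cases hthick : infDist z A < δ₀
    · -- close to `A`: inside the thickened hull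
      left
      have hzc : z ∈ cthickening δ₀ A :=
        thickening_subset_cthickening δ₀ A ((mem_thickening_iff_infDist_lt hAne).2 hthick)
      exact inter_subset_hpFill (nbhdSet A δ₀) ⟨⟨hzc, hzim.le⟩, hzH⟩
    · push Not at hthick
      have hzA : z ∉ A := fun h => by
        have h0 : infDist z A = 0 := infDist_zero_of_mem h
        linarith
      have hφzΩ : φ z ∈ Ω := hHA z hzH hzA
      right
      by_cases hzR : ‖z‖ ≤ R'
      · by_cases hzθ : θ ≤ z.im
        · -- `z ∈ K₁` pulls back into `B(0, m) ⊆ U`, so `φ z ∈ M'`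
          exfalso
          have hzK : z ∈ K₁ := ⟨hzθ, hzR, hthick⟩
          have hw1 : ψ.symm (φ z) ∈ ball (0 : ℂ) 1 := ψ.symm_mapsTo hφzΩ
          have hwm : ‖ψ.symm (φ z)‖ ≤ m := hmK _ ⟨φ z, ⟨z, hzK, rfl⟩, rfl⟩
          have hwU : ‖ψ.symm (φ z)‖ < r ((‖ψ.symm (φ z)‖⁻¹ : ℝ) • ψ.symm (φ z)) := by
            have := (hrb ((‖ψ.symm (φ z)‖⁻¹ : ℝ) • ψ.symm (φ z))).1
            linarith
          apply hφz
          rw [hMc]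
          exact ⟨ψ.symm (φ z), hwU, by rw [hext _ hw1, ψ.apply_symm_apply hφzΩ]⟩
        · push Not at hzθ
          by_cases hzr : r' ≤ ‖z‖
          · exact ⟨hzθ.le, hzr, hzR⟩
          · push Not at hzr
            exact absurd (hkey 0 ⟨hφzΩ, hr₁φ z hzH (hzr.trans_le hr'₁)⟩) hφz
      · push Not at hzR
        exact absurd (hkey 1 ⟨hφzΩ, hR₁φ z hzH (hR₁'.trans_lt hzR)⟩) hφz
  exact ⟨M', r, hrb', hMmk, hMb, hHull, hMΩ, hMflat, hKc, hlower, hupper, hMc, hMcl,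
    fun z _ hrz => (hSigcl ((hr1 z).1 hrz)).2⟩

end Summit.CriticalPhenomena.SAWScalingLimit.Theorems.ObservableToSLER.Squeeze

end
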